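import Summits.Ventures.HSemireg.WedgeHankelRecurrenceTschirnhaus
import Summits.Ventures.HSemireg.WedgeHankelRecurrenceSeparable
import Mathlib.FieldTheory.SplittingField.Construction

/-!
# Venture HSemireg — WHEN IS THE TSCHIRNHAUS TRANSFORM SEPARABLE? For `m` monic of degree `t + 1`, `a ∈ K[X]`, `T_a = χ(M_a)` (N117) and any field embedding `φ` under which `m` splits:
# **`T_a` is separable ⟺ `m` is separable AND `a` SEPARATES THE ROOTS of `m`** (`a(λ) ≠ a(λ′)` for distinct roots `λ ≠ λ′` of `φm`) — the criterion behind the choice of a separating ∕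
# primitive element and of squarefree resolvents; in general **`#{distinct roots of T_a} = #{a(λ) : λ ∈ roots(φm)} ≤ #{distinct roots of m}`** with equality iff `a` separates the distinct roots,
# and Hermite's criterion (N96) reads **`det H_t(T_a′/T_a) ≠ 0 ⟺ m separable ∧ a separating`**.

HONEST FRAMING. Part of the Lean index of the computation cell `pub-hsemireg` (seat p10 gen 32, Sunday typer «UNIFORM-IN-n»).
LINEAR ALGEBRA OF HANKEL (catalecticant) MATRICES and of polynomials over a field ONLY (`Matrix.charpoly`, `Polynomial.Separable`, `Polynomial.roots`, `Multiset.Nodup`, `Set.InjOn`): no variety, no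
cohomology theory, no sheaf, no Ext group and no semiregularity map is constructed here; «separating element» is dictionary; nothing here says that HC / HC_CM / HC_AV holds; no Literature fact is
declared or used.  Custodian versions as in `WedgeHankelSiegelIdeal` (1/3).

WHAT IS IN THE TREE.  N117 (`WedgeHankelRecurrenceTschirnhaus`): `roots_map_charpoly_mulResidueMat` (`roots(φT_a) = roots(φm).map (φa)`), `splits_map_charpoly_mulResidueMat`, `charpoly_mulResidueMat_natDegree`.
N96 (`WedgeHankelRecurrenceSeparable`): `det_hankelSq_dualSeq_derivative_ne_zero_iff` (Hermite: `det H_t(p′/p) ≠ 0 ⟺ p.Separable`, `p` monic of degree `t + 1`).  Mathlib: `nodup_roots_iff_of_splits`,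
`separable_map`, `Multiset.inj_on_of_nodup_map`, `Multiset.Nodup.map_on`, `Multiset.Nodup.of_map`, `Multiset.toFinset_map`, `Finset.card_image_le`, `Finset.card_image_iff`; Mathlib's
`Field.primitive_element_inf_aux` machinery chooses separating elements analytically (infinite fields) — no statement about `χ` of multiplication matrices.  `rg` in the tree: nothing on
separability of `χ(M_a)`.
THIS FILE (namespace `Summit.Ventures.HSemireg.Wedge.HankelOuter` continued; PLAIN on TREE N117 + N96; 0 definitions):
* §695 `separable_iff_nodup_roots_map` (any monic `p` split under `φ`: `p.Separable ⟺ roots(φp).Nodup`), **`separable_charpoly_mulResidueMat_iff`** (THE CRITERION: `T_a.Separable ⟺ m.Separable ∧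
  ∀ λ λ′ ∈ roots(φm), (φa)(λ) = (φa)(λ′) → λ = λ′`), `separable_of_separable_charpoly_mulResidueMat` (`T_a` separable ⇒ `m` separable), `separable_charpoly_mulResidueMat_X` (`a = X`: `T_X = m`).
* §696 `card_roots_toFinset_map_charpoly_mulResidueMat` (`#distinct roots of φT_a = #((roots φm).toFinset.image (φa))`), `card_roots_toFinset_map_charpoly_mulResidueMat_le` (`≤ #distinct roots of φm`),
  **`card_roots_toFinset_map_charpoly_mulResidueMat_eq_iff`** (`=` iff `a` separates the DISTINCT roots: `Set.InjOn`).
* §697 **`det_hankelSq_tschirnhaus_ne_zero_iff`** (Hermite for `T_a`: `det H_t(T_a′/T_a) ≠ 0 ⟺ m.Separable ∧ a separating`).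
Nothing Ext-side.  New names only.
-/

open Module Polynomial
open scoped Matrix Polynomial

namespace Summit.Ventures.HSemireg.Wedge.HankelOuter

open Summit.Ventures.HSemireg.Wedge Summit.Ventures.HSemireg.Wedge.Hankel

variable (K : Type*) [Field K]

/-! ## §695. `T_a` separable ⟺ `m` separable and `a` separates the roots -/

/-- A polynomial that splits under a field embedding `φ` is separable iff the roots of `φp` are simple (Mathlib's `nodup_roots_iff_of_splits` + `separable_map`). -/
theorem separable_iff_nodup_roots_map {L : Type*} [Field L] (φ : K →+* L) {p : K[X]} (hp : p ≠ 0) (hs : (p.map φ).Splits) : p.Separable ↔ (p.map φ).roots.Nodup := by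
  rw [← Polynomial.separable_map φ, Polynomial.nodup_roots_iff_of_splits (Polynomial.map_ne_zero hp) hs]

/-- **THE TSCHIRNHAUS TRANSFORM `T_a = χ(M_a)` IS SEPARABLE ⟺ `m` IS SEPARABLE AND `a` SEPARATES THE ROOTS OF `m`** (`m` monic of degree `t + 1`, `φ` any embedding under which `m` splits; the roots
of `φT_a` are the `a(λ)` with multiplicity, N117, so they are simple iff the `λ` are simple and `a` is injective on them). -/
theorem separable_charpoly_mulResidueMat_iff {L : Type*} [Field L] [DecidableEq L] (φ : K →+* L) {t : ℕ} {m : K[X]} (hm : m.Monic) (hmd : m.natDegree = t + 1) (hs : (m.map φ).Splits) (a : K[X]) :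
    (mulResidueMat K t m a).charpoly.Separable ↔ m.Separable ∧ ∀ x ∈ (m.map φ).roots, ∀ y ∈ (m.map φ).roots, (a.map φ).eval x = (a.map φ).eval y → x = y := by
  rw [separable_iff_nodup_roots_map K φ (Matrix.charpoly_monic _).ne_zero (splits_map_charpoly_mulResidueMat K φ hm hmd hs a), roots_map_charpoly_mulResidueMat K φ hm hmd hs a,
    separable_iff_nodup_roots_map K φ hm.ne_zero hs]
  exact ⟨fun h => ⟨h.of_map _, Multiset.inj_on_of_nodup_map h⟩, fun h => h.1.map_on h.2⟩

/-- `T_a` separable ⇒ `m` separable (`m` monic of degree `t + 1`; through the splitting field of `m`). -/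
theorem separable_of_separable_charpoly_mulResidueMat {t : ℕ} {m : K[X]} (hm : m.Monic) (hmd : m.natDegree = t + 1) {a : K[X]} (h : (mulResidueMat K t m a).charpoly.Separable) : m.Separable := by
  classical
  exact ((separable_charpoly_mulResidueMat_iff K (algebraMap K m.SplittingField) hm hmd (SplittingField.splits m) a).mp h).1

/-- Sanity check `a = X`: `T_X = m` (N82), so the criterion is `m.Separable ↔ m.Separable ∧ X injective on the roots`. -/
theorem separable_charpoly_mulResidueMat_X {t : ℕ} {m : K[X]} (hm : m.Monic) (hmd : m.natDegree = t + 1) : (mulResidueMat K t m Polynomial.X).charpoly.Separable ↔ m.Separable := by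
  rw [charpoly_mulResidueMat_X K hm hmd]

/-! ## §696. The number of distinct roots of `T_a` = the number of distinct values of `a` on the roots -/

/-- **`#distinct roots of φT_a = #{a(λ) : λ ∈ roots(φm)}`** (`m` monic of degree `t + 1`, `φ` a splitting embedding for `m`). -/
theorem card_roots_toFinset_map_charpoly_mulResidueMat {L : Type*} [Field L] [DecidableEq L] (φ : K →+* L) {t : ℕ} {m : K[X]} (hm : m.Monic) (hmd : m.natDegree = t + 1) (hs : (m.map φ).Splits)
    (a : K[X]) : ((mulResidueMat K t m a).charpoly.map φ).roots.toFinset.card = ((m.map φ).roots.toFinset.image fun c => (a.map φ).eval c).card := by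
  rw [roots_map_charpoly_mulResidueMat K φ hm hmd hs a, Multiset.toFinset_map]

/-- `#distinct roots of φT_a ≤ #distinct roots of φm`. -/
theorem card_roots_toFinset_map_charpoly_mulResidueMat_le {L : Type*} [Field L] [DecidableEq L] (φ : K →+* L) {t : ℕ} {m : K[X]} (hm : m.Monic) (hmd : m.natDegree = t + 1) (hs : (m.map φ).Splits)
    (a : K[X]) : ((mulResidueMat K t m a).charpoly.map φ).roots.toFinset.card ≤ (m.map φ).roots.toFinset.card := by
  rw [card_roots_toFinset_map_charpoly_mulResidueMat K φ hm hmd hs a]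
  exact Finset.card_image_le

/-- **Equality `#distinct roots of φT_a = #distinct roots of φm` holds iff `a` SEPARATES THE DISTINCT ROOTS** (`Set.InjOn` on the root set; multiplicities play no role here). -/
theorem card_roots_toFinset_map_charpoly_mulResidueMat_eq_iff {L : Type*} [Field L] [DecidableEq L] (φ : K →+* L) {t : ℕ} {m : K[X]} (hm : m.Monic) (hmd : m.natDegree = t + 1) (hs : (m.map φ).Splits)
    (a : K[X]) : ((mulResidueMat K t m a).charpoly.map φ).roots.toFinset.card = (m.map φ).roots.toFinset.card ↔ Set.InjOn (fun c => (a.map φ).eval c) ((m.map φ).roots.toFinset : Set L) := by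
  rw [card_roots_toFinset_map_charpoly_mulResidueMat K φ hm hmd hs a, Finset.card_image_iff]

/-! ## §697. Hermite's criterion for the Tschirnhaus transform -/

/-- **`det H_t(T_a′/T_a) ≠ 0 ⟺ m` separable ∧ `a` separates the roots** (`m` monic of degree `t + 1`, `φ` a splitting embedding; N96's Hermite criterion for the monic `T_a` of degree `t + 1` + §695). -/
theorem det_hankelSq_tschirnhaus_ne_zero_iff [DecidableEq K] {L : Type*} [Field L] [DecidableEq L] (φ : K →+* L) {t : ℕ} {m : K[X]} (hm : m.Monic) (hmd : m.natDegree = t + 1) (hs : (m.map φ).Splits)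
    (a : K[X]) :
    (hankelSq K t (dualSeq K (mulResidueMat K t m a).charpoly (derivative (mulResidueMat K t m a).charpoly))).det ≠ 0 ↔
      m.Separable ∧ ∀ x ∈ (m.map φ).roots, ∀ y ∈ (m.map φ).roots, (a.map φ).eval x = (a.map φ).eval y → x = y := by
  rw [det_hankelSq_dualSeq_derivative_ne_zero_iff K (Matrix.charpoly_monic _) (charpoly_mulResidueMat_natDegree K t m a), separable_charpoly_mulResidueMat_iff K φ hm hmd hs a]

end Summit.Ventures.HSemireg.Wedge.HankelOuter
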